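import Literature.Computability.Complexity.SharpSATMembership
import Literature.Computability.Complexity.ListBricks
import Literature.Computability.Complexity.ParsimoniousCookLevin

-- every `Summit.PneNP.PneNP.…` name repeats the summit = sub-problem component (layout D-0017)
set_option linter.dupNamespace false

/-!
# Compacting the variables of a coded CNF in polynomial time (support of `CalibrationSatBPP`)

Helper file for the support item `CalibrationSatBPP` (stmt-PneNP-2437) of route
`PneNP/WitnessForging`. The witness-forging thesis speaks about COMPACTLY INDEXED formulas
(`numVars φ ≤ |encode φ|`), whereas an instance of `SAT` may carry arbitrarily large binary variable
numerals; the calibration `SAT ∉ BPP → ForgingThesis` therefore first renames the variables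
("polynomial-time renaming preserving satisfiability", item text). The renaming used here is the
ORDER-PRESERVING COUNT RENAMING `v ↦ #{literal occurrences (v', b') of φ with v' < v}`
(`(φ.flatten.map Prod.fst).countP (· < v)`): it is injective on the occurring variables (an occurring
`v₁ < v₂` contributes its own occurrences to the count of `v₂`), its values are at most the number of
literal occurrences — so the renamed formula is compact —, and it is computed by two nested counting
folds, which is what makes the machine a plain brick assembly (no machine is written, no definition is
introduced): on the code `⟨1ᵐ, ⟨clause codes⟩⟩` (`encodingCNF`; clause `⟨1ᵏ, ⟨literal codes⟩⟩`, literal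
`⟨bin v, [b]⟩`) the count of `v` is a `foldFn` over the clause codes of a `foldFn` over the literal
codes adding the comparison bit `ltFn` (`ListFoldBricks.lean`, `StackBricks.lean`), and the renamed
code is the nested in-order map `mapLF` (`ListBricks.lean`) replacing each literal numeral by its count.

Main result: `exists_compactFn` — there is `F ∈ FP` with
`F (encode φ) = encode (CNF.rename (fun v => (φ.flatten.map Prod.fst).countP (· < v)) φ)` for every
CNF `φ` over `ℕ` (`CNF.rename` of `ParsimoniousCookLevin.lean`).

## References

* S. Arora, B. Barak, *Computational Complexity: A Modern Approach*, CUP 2009, §1.3 (polynomial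
  time is closed under composition and bounded loops), §0.1 (codes of lists and numerals).
* O. Goldreich, *Foundations of Cryptography I*, CUP 2001, §2.7.3.
-/

namespace Summit.PneNP.PneNP.Theorems.CalibrationSatBPP

open Literature.Computability.Complexity _root_.Computability Brick Polynomial

/-! ### Two small generic facts -/

/-- A left fold whose step grows the accumulator by at most `g a` has output length at most
`|acc| + Σ g a`. [folklore] -/
theorem length_foldl_le (f : List Bool → List Bool → List Bool) (g : List Bool → ℕ)
    (hf : ∀ acc a, (f acc a).length ≤ acc.length + g a) :
    ∀ (l : List (List Bool)) (acc : List Bool), (l.foldl f acc).length ≤ acc.length + (l.map g).sum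
  | [], acc => by simp
  | a :: l, acc => by
    rw [List.foldl_cons, List.map_cons, List.sum_cons]
    exact (length_foldl_le f g hf l (f acc a)).trans (by have := hf acc a; omega)

/-- The value of a one-bit numeral: `⟦[b]⟧ = [b]`. [folklore] -/
theorem bitsToNat_single (b : Bool) : bitsToNat [b] = if b then 1 else 0 := by
  cases b <;> simp

/-! ### The counting fold: `⟨q, ⟨clause codes⟩⟩ ↦ bin #{literal numerals of value < ⟦q⟧}` -/

/-- **The inner step** on `⟨W', ⟨lit, acc⟩⟩` (`W' = ⟨⟨q, acc₀⟩, literal codes⟩`): add to `⟦acc⟧` the bit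
`[⟦fstF lit⟧ < ⟦q⟧]`. [folklore] -/
theorem innerStep_apply (W' lit acc : List Bool) :
    (addFn ∘ fanoutFn (sndF ∘ sndF) (ltFn ∘ fanoutFn (fstF ∘ fstF ∘ sndF) (fstF ∘ fstF ∘ fstF)))
        (boolPair W' (boolPair lit acc)) =
      encodeNat (bitsToNat acc + if bitsToNat (fstF lit) < bitsToNat (fstF (fstF W')) then 1 else 0) := by
  simp only [Function.comp_apply, fanoutFn_apply, sndF_boolPair, fstF_boolPair, addFn_boolPair,
    ltFn_boolPair, bitsToNat_single, decide_eq_true_eq]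

/-- The inner fold from a canonical accumulator counts the passing literal codes. [folklore] -/
theorem foldl_innerStep (W' : List Bool) : ∀ (l : List (List Bool)) (n : ℕ),
    l.foldl (fun acc a => (addFn ∘ fanoutFn (sndF ∘ sndF) (ltFn ∘ fanoutFn (fstF ∘ fstF ∘ sndF)
        (fstF ∘ fstF ∘ fstF))) (boolPair W' (boolPair a acc))) (encodeNat n) =
      encodeNat (n + l.countP fun a => decide (bitsToNat (fstF a) < bitsToNat (fstF (fstF W'))))
  | [], n => by simp
  | a :: l, n => by
    rw [List.foldl_cons, innerStep_apply, bitsToNat_encodeNat, foldl_innerStep W' l, List.countP_cons]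
    congr 1
    by_cases h : bitsToNat (fstF a) < bitsToNat (fstF (fstF W'))
    · rw [if_pos h, decide_eq_true h, if_pos rfl]; omega
    · rw [if_neg h, decide_eq_false h, if_neg Bool.false_ne_true]; omega

/-- The inner step grows the accumulator by at most one symbol (`FoldGrowth 1`). [folklore] -/
theorem foldGrowth_innerStep :
    FoldGrowth 1 (addFn ∘ fanoutFn (sndF ∘ sndF) (ltFn ∘ fanoutFn (fstF ∘ fstF ∘ sndF) (fstF ∘ fstF ∘ fstF))) := by
  intro v
  have h1 := length_encodeNat_succ_le (bitsToNat (sndF (sndF v)))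
  have h2 := Brick.length_encodeNat_bitsToNat_le (sndF (sndF v))
  simp only [Function.comp_apply, fanoutFn_apply, addFn_boolPair, ltFn_boolPair, bitsToNat_single,
    decide_eq_true_eq]
  by_cases h : bitsToNat (fstF (fstF (sndF v))) < bitsToNat (fstF (fstF (fstF v)))
  · rw [if_pos h]; omega
  · rw [if_neg h, Nat.add_zero]; omega

/-- The inner step is in `FP`. [cite: AroraBarakCC2009, §1.3] -/
theorem innerStep_mem_FP :
    (addFn ∘ fanoutFn (sndF ∘ sndF) (ltFn ∘ fanoutFn (fstF ∘ fstF ∘ sndF) (fstF ∘ fstF ∘ fstF))) ∈ FP :=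
  comp_mem_FP addFn_mem_FP (fanoutFn_mem_FP (comp_mem_FP sndF_mem_FP sndF_mem_FP)
    (comp_mem_FP ltFn_mem_FP (fanoutFn_mem_FP (comp_mem_FP fstF_mem_FP (comp_mem_FP fstF_mem_FP sndF_mem_FP))
      (comp_mem_FP fstF_mem_FP (comp_mem_FP fstF_mem_FP fstF_mem_FP)))))

/-- **The inner fold** `foldFn innerStep (sndF ∘ fstF)` on `⟨⟨q, bin n⟩, L⟩`: `bin (n + #{a ∈ decNil L |
⟦fstF a⟧ < ⟦q⟧})`. [folklore] -/
theorem innerFold_apply (q L : List Bool) (n : ℕ) :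
    foldFn (addFn ∘ fanoutFn (sndF ∘ sndF) (ltFn ∘ fanoutFn (fstF ∘ fstF ∘ sndF) (fstF ∘ fstF ∘ fstF)))
        (sndF ∘ fstF) (boolPair (boolPair q (encodeNat n)) L) =
      encodeNat (n + (decNil L).countP fun a => decide (bitsToNat (fstF a) < bitsToNat q)) := by
  have h := foldl_innerStep (boolPair (boolPair q (encodeNat n)) L) (decNil L) n
  simp only [fstF_boolPair] at h
  rw [foldFn_boolPair, Function.comp_apply, fstF_boolPair, sndF_boolPair, h]

/-- Total output length of the inner fold: at most `|acc₀| + |L|` on `W'` with `acc₀ = sndF (fstF W')`,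
`L = sndF W'`. [folklore] -/
theorem length_innerFold_le (W' : List Bool) :
    (foldFn (addFn ∘ fanoutFn (sndF ∘ sndF) (ltFn ∘ fanoutFn (fstF ∘ fstF ∘ sndF) (fstF ∘ fstF ∘ fstF)))
        (sndF ∘ fstF) W').length ≤ (sndF (fstF W')).length + (sndF W').length := by
  rw [foldFn_apply, Function.comp_apply]
  refine (length_foldl_le _ (fun _ => 1) (fun acc a => ?_) _ _).trans ?_
  · have h1 := length_encodeNat_succ_le (bitsToNat acc)
    have h2 := Brick.length_encodeNat_bitsToNat_le acc
    rw [innerStep_apply]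
    by_cases h : bitsToNat (fstF a) < bitsToNat (fstF (fstF W'))
    · rw [if_pos h]; omega
    · rw [if_neg h, Nat.add_zero]; omega
  · have := length_decNil_le (sndF W')
    simp only [List.map_const', List.sum_replicate, smul_eq_mul, mul_one]
    omega

/-- **The outer step** on `⟨W, ⟨a, acc⟩⟩` (`W = ⟨q, clause codes⟩`, `a` a clause code): the inner fold
over the literal codes `sndF a` from `acc`. [folklore] -/
theorem outerStep_apply (W a acc : List Bool) :
    (foldFn (addFn ∘ fanoutFn (sndF ∘ sndF) (ltFn ∘ fanoutFn (fstF ∘ fstF ∘ sndF) (fstF ∘ fstF ∘ fstF)))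
        (sndF ∘ fstF) ∘ fanoutFn (fanoutFn (fstF ∘ fstF) (sndF ∘ sndF)) (sndF ∘ fstF ∘ sndF))
        (boolPair W (boolPair a acc)) =
      foldFn (addFn ∘ fanoutFn (sndF ∘ sndF) (ltFn ∘ fanoutFn (fstF ∘ fstF ∘ sndF) (fstF ∘ fstF ∘ fstF)))
        (sndF ∘ fstF) (boolPair (boolPair (fstF W) acc) (sndF a)) := by
  simp only [Function.comp_apply, fanoutFn_apply, fstF_boolPair, sndF_boolPair]

/-- The outer step keeps the growth allowance (`FoldGrowth 0`: the inner fold adds at most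
`|sndF a| ≤ 4|a|` symbols). [folklore] -/
theorem foldGrowth_outerStep :
    FoldGrowth 0 (foldFn (addFn ∘ fanoutFn (sndF ∘ sndF) (ltFn ∘ fanoutFn (fstF ∘ fstF ∘ sndF)
        (fstF ∘ fstF ∘ fstF))) (sndF ∘ fstF) ∘
      fanoutFn (fanoutFn (fstF ∘ fstF) (sndF ∘ sndF)) (sndF ∘ fstF ∘ sndF)) := by
  intro v
  have h := length_innerFold_le (boolPair (boolPair (fstF (fstF v)) (sndF (sndF v))) (sndF (fstF (sndF v))))
  have h2 := length_fstF_sndF_le (fstF (sndF v))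
  simp only [fstF_boolPair, sndF_boolPair] at h
  simp only [Function.comp_apply, fanoutFn_apply]
  omega

/-- The outer step is in `FP`. [cite: AroraBarakCC2009, §1.3] -/
theorem outerStep_mem_FP :
    (foldFn (addFn ∘ fanoutFn (sndF ∘ sndF) (ltFn ∘ fanoutFn (fstF ∘ fstF ∘ sndF) (fstF ∘ fstF ∘ fstF)))
        (sndF ∘ fstF) ∘ fanoutFn (fanoutFn (fstF ∘ fstF) (sndF ∘ sndF)) (sndF ∘ fstF ∘ sndF)) ∈ FP :=
  comp_mem_FP (foldFn_mem_FP innerStep_mem_FP (comp_mem_FP sndF_mem_FP fstF_mem_FP) foldGrowth_innerStep)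
    (fanoutFn_mem_FP (fanoutFn_mem_FP (comp_mem_FP fstF_mem_FP fstF_mem_FP) (comp_mem_FP sndF_mem_FP sndF_mem_FP))
      (comp_mem_FP sndF_mem_FP (comp_mem_FP fstF_mem_FP sndF_mem_FP)))

/-- The outer fold from a canonical accumulator: the sum of the clause counts. [folklore] -/
theorem foldl_outerStep (W : List Bool) : ∀ (l : List (List Bool)) (n : ℕ),
    l.foldl (fun acc a => (foldFn (addFn ∘ fanoutFn (sndF ∘ sndF) (ltFn ∘ fanoutFn (fstF ∘ fstF ∘ sndF)
        (fstF ∘ fstF ∘ fstF))) (sndF ∘ fstF) ∘ fanoutFn (fanoutFn (fstF ∘ fstF) (sndF ∘ sndF))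
        (sndF ∘ fstF ∘ sndF)) (boolPair W (boolPair a acc))) (encodeNat n) =
      encodeNat (n + (l.map fun a => (decNil (sndF a)).countP fun lit =>
        decide (bitsToNat (fstF lit) < bitsToNat (fstF W))).sum)
  | [], n => by simp
  | a :: l, n => by
    rw [List.foldl_cons, outerStep_apply, innerFold_apply, foldl_outerStep W l, List.map_cons, List.sum_cons,
      Nat.add_assoc]

/-- **Value of the counting fold** `cntFn = foldFn outerStep (fun _ => ε)` on `⟨q, encList Lc⟩`.
[cite: AroraBarakCC2009, §1.3 (bounded loops)] -/
theorem cntFn_boolPair (q : List Bool) (Lc : List (List Bool)) :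
    foldFn (foldFn (addFn ∘ fanoutFn (sndF ∘ sndF) (ltFn ∘ fanoutFn (fstF ∘ fstF ∘ sndF)
        (fstF ∘ fstF ∘ fstF))) (sndF ∘ fstF) ∘ fanoutFn (fanoutFn (fstF ∘ fstF) (sndF ∘ sndF))
        (sndF ∘ fstF ∘ sndF)) (fun _ => []) (boolPair q (encList Lc)) =
      encodeNat (Lc.map fun a => (decNil (sndF a)).countP fun lit =>
        decide (bitsToNat (fstF lit) < bitsToNat q)).sum := by
  rw [foldFn_boolPair, decNil_encList, show ([] : List Bool) = encodeNat 0 from rfl, foldl_outerStep]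
  simp only [fstF_boolPair, Nat.zero_add]

/-- **Total output length of the counting fold**: `|cntFn W| ≤ |sndF W|` on every input. [folklore] -/
theorem length_cntFn_le (W : List Bool) :
    (foldFn (foldFn (addFn ∘ fanoutFn (sndF ∘ sndF) (ltFn ∘ fanoutFn (fstF ∘ fstF ∘ sndF)
        (fstF ∘ fstF ∘ fstF))) (sndF ∘ fstF) ∘ fanoutFn (fanoutFn (fstF ∘ fstF) (sndF ∘ sndF))
        (sndF ∘ fstF ∘ sndF)) (fun _ => []) W).length ≤ (sndF W).length := by
  rw [foldFn_apply]
  refine (length_foldl_le _ (fun a => 2 * a.length) (fun acc a => ?_) _ _).trans ?_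
  · rw [outerStep_apply]
    have h := length_innerFold_le (boolPair (boolPair (fstF W) acc) (sndF a))
    have h2 := length_fstF_sndF_le a
    simp only [fstF_boolPair, sndF_boolPair] at h
    omega
  · simpa using sum_decNil_le (sndF W)

/-- **The counting fold is in `FP`.** [cite: AroraBarakCC2009, §1.3 (bounded loops)] -/
theorem cntFn_mem_FP :
    foldFn (foldFn (addFn ∘ fanoutFn (sndF ∘ sndF) (ltFn ∘ fanoutFn (fstF ∘ fstF ∘ sndF)
        (fstF ∘ fstF ∘ fstF))) (sndF ∘ fstF) ∘ fanoutFn (fanoutFn (fstF ∘ fstF) (sndF ∘ sndF))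
        (sndF ∘ fstF ∘ sndF)) (fun _ => []) ∈ FP :=
  foldFn_mem_FP outerStep_mem_FP (const_mem_FP _) foldGrowth_outerStep

/-- The count on a genuine CNF code: `#{literal occurrences with variable < v}`. [folklore] -/
theorem cntFn_encode (φ : CNF ℕ) (v : ℕ) :
    foldFn (foldFn (addFn ∘ fanoutFn (sndF ∘ sndF) (ltFn ∘ fanoutFn (fstF ∘ fstF ∘ sndF)
        (fstF ∘ fstF ∘ fstF))) (sndF ∘ fstF) ∘ fanoutFn (fanoutFn (fstF ∘ fstF) (sndF ∘ sndF))
        (sndF ∘ fstF ∘ sndF)) (fun _ => []) (boolPair (encodeNat v) (sndF (encodingCNF.encode φ))) =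
      encodeNat ((φ.flatten.map Prod.fst).countP (· < v)) := by
  rw [SharpSATVerif.encode_cnf, sndF_boolPair, cntFn_boolPair, bitsToNat_encodeNat]
  congr 1
  induction φ with
  | nil => simp
  | cons c φ ih =>
    rw [List.map_cons, List.map_cons, List.sum_cons, ih, List.flatten_cons, List.map_append,
      List.countP_append, SharpSATVerif.encode_clause, sndF_boolPair, decNil_encList]
    congr 1
    rw [List.countP_map, List.countP_map]
    refine List.countP_congr fun l _ => ?_
    simp [SharpSATVerif.encode_literal]

/-! ### The literal map: `⟨x, ⟨p, ⟨bin v, [b]⟩⟩⟩ ↦ ⟨cntFn ⟨bin v, sndF x⟩, [b]⟩` -/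

/-- **The literal map** on an item argument: the numeral is replaced by its count against the clause
list `sndF x` of the yardstick `x` (the code of the whole formula). [folklore] -/
theorem litMap_apply (x p lit : List Bool) :
    fanoutFn (foldFn (foldFn (addFn ∘ fanoutFn (sndF ∘ sndF) (ltFn ∘ fanoutFn (fstF ∘ fstF ∘ sndF)
        (fstF ∘ fstF ∘ fstF))) (sndF ∘ fstF) ∘ fanoutFn (fanoutFn (fstF ∘ fstF) (sndF ∘ sndF))
        (sndF ∘ fstF ∘ sndF)) (fun _ => []) ∘ fanoutFn (fstF ∘ sndF ∘ sndF) (sndF ∘ fstF)) (sndF ∘ sndF ∘ sndF)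
        (boolPair x (boolPair p lit)) =
      boolPair (foldFn (foldFn (addFn ∘ fanoutFn (sndF ∘ sndF) (ltFn ∘ fanoutFn (fstF ∘ fstF ∘ sndF)
        (fstF ∘ fstF ∘ fstF))) (sndF ∘ fstF) ∘ fanoutFn (fanoutFn (fstF ∘ fstF) (sndF ∘ sndF))
        (sndF ∘ fstF ∘ sndF)) (fun _ => []) (boolPair (fstF lit) (sndF x))) (sndF lit) := by
  simp only [fanoutFn_apply, Function.comp_apply, fstF_boolPair, sndF_boolPair]

/-- **The literal map on a genuine literal code**: the code of the renamed literal. [folklore] -/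
theorem litMap_encode (φ : CNF ℕ) (p : List Bool) (l : Literal ℕ) :
    fanoutFn (foldFn (foldFn (addFn ∘ fanoutFn (sndF ∘ sndF) (ltFn ∘ fanoutFn (fstF ∘ fstF ∘ sndF)
        (fstF ∘ fstF ∘ fstF))) (sndF ∘ fstF) ∘ fanoutFn (fanoutFn (fstF ∘ fstF) (sndF ∘ sndF))
        (sndF ∘ fstF ∘ sndF)) (fun _ => []) ∘ fanoutFn (fstF ∘ sndF ∘ sndF) (sndF ∘ fstF)) (sndF ∘ sndF ∘ sndF)
        (boolPair (encodingCNF.encode φ) (boolPair p (encodingLiteral.encode l))) =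
      encodingLiteral.encode (CookLevin.renLit (fun v => (φ.flatten.map Prod.fst).countP (· < v)) l) := by
  rw [litMap_apply, SharpSATVerif.encode_literal, fstF_boolPair, sndF_boolPair, cntFn_encode,
    SharpSATVerif.encode_literal]
  rfl

/-- Total output length of the literal map: `≤ |lit| + (2|x| + 2)`. [folklore] -/
theorem length_litMap_le (x p lit : List Bool) :
    (fanoutFn (foldFn (foldFn (addFn ∘ fanoutFn (sndF ∘ sndF) (ltFn ∘ fanoutFn (fstF ∘ fstF ∘ sndF)
        (fstF ∘ fstF ∘ fstF))) (sndF ∘ fstF) ∘ fanoutFn (fanoutFn (fstF ∘ fstF) (sndF ∘ sndF))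
        (sndF ∘ fstF ∘ sndF)) (fun _ => []) ∘ fanoutFn (fstF ∘ sndF ∘ sndF) (sndF ∘ fstF)) (sndF ∘ sndF ∘ sndF)
        (boolPair x (boolPair p lit))).length ≤ 1 * lit.length + (2 * X + 2 : Polynomial ℕ).eval x.length := by
  rw [litMap_apply, length_boolPair]
  have h1 := length_cntFn_le (boolPair (fstF lit) (sndF x))
  rw [sndF_boolPair] at h1
  have h2 := length_fstF_sndF_le x
  have h3 := length_fstF_sndF_le lit
  simp only [eval_add, eval_mul, eval_ofNat, eval_X]
  omega

/-- The literal map is in `FP`. [cite: AroraBarakCC2009, §1.3] -/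
theorem litMap_mem_FP :
    fanoutFn (foldFn (foldFn (addFn ∘ fanoutFn (sndF ∘ sndF) (ltFn ∘ fanoutFn (fstF ∘ fstF ∘ sndF)
        (fstF ∘ fstF ∘ fstF))) (sndF ∘ fstF) ∘ fanoutFn (fanoutFn (fstF ∘ fstF) (sndF ∘ sndF))
        (sndF ∘ fstF ∘ sndF)) (fun _ => []) ∘ fanoutFn (fstF ∘ sndF ∘ sndF) (sndF ∘ fstF)) (sndF ∘ sndF ∘ sndF) ∈ FP :=
  fanoutFn_mem_FP (comp_mem_FP cntFn_mem_FP (fanoutFn_mem_FP (comp_mem_FP fstF_mem_FP (comp_mem_FP sndF_mem_FP sndF_mem_FP))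
    (comp_mem_FP sndF_mem_FP fstF_mem_FP))) (comp_mem_FP sndF_mem_FP (comp_mem_FP sndF_mem_FP sndF_mem_FP))

/-! ### The clause map: rename every literal of a clause code -/

/-- **The clause map** on an item argument `⟨x, ⟨p, a⟩⟩`: keep the header `fstF a`, map the literal
codes `sndF a` (counter `lenBinF (fstF a)`, empty parameter, yardstick `x`). [folklore] -/
theorem clMap_apply (x p a : List Bool) :
    fanoutFn (fstF ∘ sndF ∘ sndF) (mapLF (fanoutFn (foldFn (foldFn (addFn ∘ fanoutFn (sndF ∘ sndF) (ltFn ∘ fanoutFn (fstF ∘ fstF ∘ sndF)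
        (fstF ∘ fstF ∘ fstF))) (sndF ∘ fstF) ∘ fanoutFn (fanoutFn (fstF ∘ fstF) (sndF ∘ sndF))
        (sndF ∘ fstF ∘ sndF)) (fun _ => []) ∘ fanoutFn (fstF ∘ sndF ∘ sndF) (sndF ∘ fstF)) (sndF ∘ sndF ∘ sndF)) ∘
        fanoutFn fstF (fanoutFn (lenBinF ∘ fstF ∘ sndF ∘ sndF) (fanoutFn (fun _ => []) (sndF ∘ sndF ∘ sndF))))
        (boolPair x (boolPair p a)) =
      boolPair (fstF a) (mapLF (fanoutFn (foldFn (foldFn (addFn ∘ fanoutFn (sndF ∘ sndF) (ltFn ∘ fanoutFn (fstF ∘ fstF ∘ sndF)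
        (fstF ∘ fstF ∘ fstF))) (sndF ∘ fstF) ∘ fanoutFn (fanoutFn (fstF ∘ fstF) (sndF ∘ sndF))
        (sndF ∘ fstF ∘ sndF)) (fun _ => []) ∘ fanoutFn (fstF ∘ sndF ∘ sndF) (sndF ∘ fstF)) (sndF ∘ sndF ∘ sndF))
        (boolPair x (boolPair (lenBinF (fstF a)) (boolPair [] (sndF a))))) := by
  simp only [fanoutFn_apply, Function.comp_apply, fstF_boolPair, sndF_boolPair]

/-- **The clause map on a genuine clause code** `⟨1ᵏ, ⟨literal codes⟩⟩` (yardstick `x = encode φ` with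
`k ≤ |x|`): the in-order map `mapLF` of the literal map over the `k` literal codes, re-headed by `1ᵏ` —
the code of the renamed clause. [cite: AroraBarakCC2009, §1.3 (bounded loops)] -/
theorem clMap_encode (φ : CNF ℕ) (p : List Bool) (c : Clause ℕ)
    (hk : c.length ≤ (encodingCNF.encode φ).length) :
    fanoutFn (fstF ∘ sndF ∘ sndF) (mapLF (fanoutFn (foldFn (foldFn (addFn ∘ fanoutFn (sndF ∘ sndF) (ltFn ∘ fanoutFn (fstF ∘ fstF ∘ sndF)
        (fstF ∘ fstF ∘ fstF))) (sndF ∘ fstF) ∘ fanoutFn (fanoutFn (fstF ∘ fstF) (sndF ∘ sndF))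
        (sndF ∘ fstF ∘ sndF)) (fun _ => []) ∘ fanoutFn (fstF ∘ sndF ∘ sndF) (sndF ∘ fstF)) (sndF ∘ sndF ∘ sndF)) ∘
        fanoutFn fstF (fanoutFn (lenBinF ∘ fstF ∘ sndF ∘ sndF) (fanoutFn (fun _ => []) (sndF ∘ sndF ∘ sndF))))
        (boolPair (encodingCNF.encode φ) (boolPair p (encodingClause.encode c))) =
      encodingClause.encode (c.map (CookLevin.renLit fun v => (φ.flatten.map Prod.fst).countP (· < v))) := by
  rw [clMap_apply, SharpSATVerif.encode_clause c, fstF_boolPair, sndF_boolPair, lenBinF_apply,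
    show (unaryEncodeNat c.length).length = c.length from unary_decode_encode_nat _, mapLF_apply _ _ _ hk, List.take_of_length_le (List.length_map _).le, List.map_map,
    SharpSATVerif.encode_clause, List.length_map, List.map_map]
  have hmap : c.map ((fun a => fanoutFn (foldFn (foldFn (addFn ∘ fanoutFn (sndF ∘ sndF) (ltFn ∘ fanoutFn (fstF ∘ fstF ∘ sndF)
        (fstF ∘ fstF ∘ fstF))) (sndF ∘ fstF) ∘ fanoutFn (fanoutFn (fstF ∘ fstF) (sndF ∘ sndF))
        (sndF ∘ fstF ∘ sndF)) (fun _ => []) ∘ fanoutFn (fstF ∘ sndF ∘ sndF) (sndF ∘ fstF)) (sndF ∘ sndF ∘ sndF) (boolPair (encodingCNF.encode φ) (boolPair [] a))) ∘ encodingLiteral.encode) =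
      c.map (encodingLiteral.encode ∘ CookLevin.renLit fun v => (φ.flatten.map Prod.fst).countP (· < v)) :=
    List.map_congr_left fun l _ => litMap_encode φ [] l
  rw [hmap]

/-- Total output length of the clause map: `≤ 2|a| + (4|x|² + 8|x| + 4)` (`sndPow 2` of the map record is
the literal list `sndF a`). [folklore] -/
theorem length_clMap_le (x p a : List Bool) :
    (fanoutFn (fstF ∘ sndF ∘ sndF) (mapLF (fanoutFn (foldFn (foldFn (addFn ∘ fanoutFn (sndF ∘ sndF) (ltFn ∘ fanoutFn (fstF ∘ fstF ∘ sndF)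
        (fstF ∘ fstF ∘ fstF))) (sndF ∘ fstF) ∘ fanoutFn (fanoutFn (fstF ∘ fstF) (sndF ∘ sndF))
        (sndF ∘ fstF ∘ sndF)) (fun _ => []) ∘ fanoutFn (fstF ∘ sndF ∘ sndF) (sndF ∘ fstF)) (sndF ∘ sndF ∘ sndF)) ∘
        fanoutFn fstF (fanoutFn (lenBinF ∘ fstF ∘ sndF ∘ sndF) (fanoutFn (fun _ => []) (sndF ∘ sndF ∘ sndF))))
        (boolPair x (boolPair p a))).length ≤ 2 * a.length + (4 * X ^ 2 + 8 * X + 4 : Polynomial ℕ).eval x.length := by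
  rw [clMap_apply, length_boolPair]
  have h := length_mapLF_le 1 (P := 2 * X + 2) length_litMap_le
    (boolPair x (boolPair (lenBinF (fstF a)) (boolPair [] (sndF a))))
  simp only [sndPow_succ_boolPair, sndPow_zero_boolPair, fstF_boolPair, eval_add, eval_mul, eval_ofNat, eval_X,
    eval_pow] at h ⊢
  have h2 := length_fstF_sndF_le a
  nlinarith [h, h2]

/-- The clause map is in `FP`. [cite: AroraBarakCC2009, §1.3] -/
theorem clMap_mem_FP :
    fanoutFn (fstF ∘ sndF ∘ sndF) (mapLF (fanoutFn (foldFn (foldFn (addFn ∘ fanoutFn (sndF ∘ sndF) (ltFn ∘ fanoutFn (fstF ∘ fstF ∘ sndF)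
        (fstF ∘ fstF ∘ fstF))) (sndF ∘ fstF) ∘ fanoutFn (fanoutFn (fstF ∘ fstF) (sndF ∘ sndF))
        (sndF ∘ fstF ∘ sndF)) (fun _ => []) ∘ fanoutFn (fstF ∘ sndF ∘ sndF) (sndF ∘ fstF)) (sndF ∘ sndF ∘ sndF)) ∘
        fanoutFn fstF (fanoutFn (lenBinF ∘ fstF ∘ sndF ∘ sndF) (fanoutFn (fun _ => []) (sndF ∘ sndF ∘ sndF)))) ∈ FP :=
  fanoutFn_mem_FP (comp_mem_FP fstF_mem_FP (comp_mem_FP sndF_mem_FP sndF_mem_FP))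
    (comp_mem_FP (mapLF_mem_FP litMap_mem_FP (w := 1) (by norm_num) length_litMap_le)
      (fanoutFn_mem_FP fstF_mem_FP (fanoutFn_mem_FP
        (comp_mem_FP lenBinF_mem_FP (comp_mem_FP fstF_mem_FP (comp_mem_FP sndF_mem_FP sndF_mem_FP)))
        (fanoutFn_mem_FP (const_mem_FP _) (comp_mem_FP sndF_mem_FP (comp_mem_FP sndF_mem_FP sndF_mem_FP))))))

/-! ### The compaction map -/

/-- A clause of `φ` is not longer than the code of `φ`. [folklore] -/
theorem length_clause_le_length_encode {φ : CNF ℕ} {c : Clause ℕ} (hc : c ∈ φ) :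
    c.length ≤ (encodingCNF.encode φ).length := by
  rw [SharpSATVerif.encode_cnf, length_boolPair]
  have h1 : 2 * (encodingClause.encode c).length ≤ (encList (φ.map encodingClause.encode)).length := by
    refine two_mul_length_le_of_mem_decNil ?_
    rw [decNil_encList]
    exact List.mem_map.2 ⟨c, hc, rfl⟩
  rw [SharpSATVerif.encode_clause, length_boolPair,
    show (unaryEncodeNat c.length).length = c.length from unary_decode_encode_nat _] at h1
  omega

/-- **Variable compaction is polynomial time.** There is `F ∈ FP` sending the code of every CNF `φ`
over `ℕ` to the code of `φ` with each variable `v` renamed to the number of literal occurrences of `φ`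
whose variable is `< v` (`CNF.rename`, the order-preserving count renaming): the in-order map of the
clause map over the clause codes, re-headed by `1ᵐ`. [cite: AroraBarakCC2009, §1.3 (composition and bounded loops)] -/
theorem exists_compactFn :
    ∃ F : List Bool → List Bool, F ∈ FP ∧ ∀ φ : CNF ℕ, F (encodingCNF.encode φ) =
      encodingCNF.encode (CNF.rename (fun v => (φ.flatten.map Prod.fst).countP (· < v)) φ) := by
  refine ⟨fanoutFn fstF (mapLF (fanoutFn (fstF ∘ sndF ∘ sndF) (mapLF (fanoutFn (foldFn (foldFn (addFn ∘ fanoutFn (sndF ∘ sndF) (ltFn ∘ fanoutFn (fstF ∘ fstF ∘ sndF)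
        (fstF ∘ fstF ∘ fstF))) (sndF ∘ fstF) ∘ fanoutFn (fanoutFn (fstF ∘ fstF) (sndF ∘ sndF))
        (sndF ∘ fstF ∘ sndF)) (fun _ => []) ∘ fanoutFn (fstF ∘ sndF ∘ sndF) (sndF ∘ fstF)) (sndF ∘ sndF ∘ sndF)) ∘
        fanoutFn fstF (fanoutFn (lenBinF ∘ fstF ∘ sndF ∘ sndF) (fanoutFn (fun _ => []) (sndF ∘ sndF ∘ sndF))))) ∘
        fanoutFn id (fanoutFn (lenBinF ∘ fstF) (fanoutFn (fun _ => []) sndF))), ?_, fun φ => ?_⟩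
  · exact fanoutFn_mem_FP fstF_mem_FP (comp_mem_FP (mapLF_mem_FP clMap_mem_FP (w := 2) le_rfl length_clMap_le)
      (fanoutFn_mem_FP OracleCompose.id_mem_FP (fanoutFn_mem_FP (comp_mem_FP lenBinF_mem_FP fstF_mem_FP)
        (fanoutFn_mem_FP (const_mem_FP _) sndF_mem_FP))))
  · have hlen : (unaryEncodeNat φ.length).length = φ.length := unary_decode_encode_nat _
    have hm : φ.length ≤ (encodingCNF.encode φ).length := by
      rw [SharpSATVerif.encode_cnf, length_boolPair, hlen]; omega
    have hfst : fstF (encodingCNF.encode φ) = unaryEncodeNat φ.length := by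
      rw [SharpSATVerif.encode_cnf, fstF_boolPair]
    have eF : fanoutFn fstF (mapLF (fanoutFn (fstF ∘ sndF ∘ sndF) (mapLF (fanoutFn (foldFn (foldFn (addFn ∘ fanoutFn (sndF ∘ sndF) (ltFn ∘ fanoutFn (fstF ∘ fstF ∘ sndF)
        (fstF ∘ fstF ∘ fstF))) (sndF ∘ fstF) ∘ fanoutFn (fanoutFn (fstF ∘ fstF) (sndF ∘ sndF))
        (sndF ∘ fstF ∘ sndF)) (fun _ => []) ∘ fanoutFn (fstF ∘ sndF ∘ sndF) (sndF ∘ fstF)) (sndF ∘ sndF ∘ sndF)) ∘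
        fanoutFn fstF (fanoutFn (lenBinF ∘ fstF ∘ sndF ∘ sndF) (fanoutFn (fun _ => []) (sndF ∘ sndF ∘ sndF))))) ∘
        fanoutFn id (fanoutFn (lenBinF ∘ fstF) (fanoutFn (fun _ => []) sndF))) (encodingCNF.encode φ) =
        boolPair (fstF (encodingCNF.encode φ)) (mapLF (fanoutFn (fstF ∘ sndF ∘ sndF) (mapLF (fanoutFn (foldFn (foldFn (addFn ∘ fanoutFn (sndF ∘ sndF) (ltFn ∘ fanoutFn (fstF ∘ fstF ∘ sndF)
        (fstF ∘ fstF ∘ fstF))) (sndF ∘ fstF) ∘ fanoutFn (fanoutFn (fstF ∘ fstF) (sndF ∘ sndF))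
        (sndF ∘ fstF ∘ sndF)) (fun _ => []) ∘ fanoutFn (fstF ∘ sndF ∘ sndF) (sndF ∘ fstF)) (sndF ∘ sndF ∘ sndF)) ∘
        fanoutFn fstF (fanoutFn (lenBinF ∘ fstF ∘ sndF ∘ sndF) (fanoutFn (fun _ => []) (sndF ∘ sndF ∘ sndF))))) (boolPair (encodingCNF.encode φ)
          (boolPair (lenBinF (fstF (encodingCNF.encode φ))) (boolPair [] (sndF (encodingCNF.encode φ)))))) := by
      simp only [fanoutFn_apply, Function.comp_apply, id]
    rw [eF, hfst, SharpSATVerif.sndF_encode_cnf, lenBinF_apply, hlen, mapLF_apply _ _ _ hm,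
      List.take_of_length_le (List.length_map _).le, List.map_map, SharpSATVerif.encode_cnf (CNF.rename _ φ)]
    have hmap : φ.map ((fun a => fanoutFn (fstF ∘ sndF ∘ sndF) (mapLF (fanoutFn (foldFn (foldFn (addFn ∘ fanoutFn (sndF ∘ sndF) (ltFn ∘ fanoutFn (fstF ∘ fstF ∘ sndF)
        (fstF ∘ fstF ∘ fstF))) (sndF ∘ fstF) ∘ fanoutFn (fanoutFn (fstF ∘ fstF) (sndF ∘ sndF))
        (sndF ∘ fstF ∘ sndF)) (fun _ => []) ∘ fanoutFn (fstF ∘ sndF ∘ sndF) (sndF ∘ fstF)) (sndF ∘ sndF ∘ sndF)) ∘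
        fanoutFn fstF (fanoutFn (lenBinF ∘ fstF ∘ sndF ∘ sndF) (fanoutFn (fun _ => []) (sndF ∘ sndF ∘ sndF)))) (boolPair (encodingCNF.encode φ) (boolPair [] a))) ∘ encodingClause.encode) =
        φ.map (encodingClause.encode ∘ fun c => c.map
          (CookLevin.renLit fun v => (φ.flatten.map Prod.fst).countP (· < v))) :=
      List.map_congr_left fun c hc => clMap_encode φ [] c (length_clause_le_length_encode hc)
    rw [hmap, ← List.map_map, List.length_map]

end Summit.PneNP.PneNP.Theorems.CalibrationSatBPP
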